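import Summits.AtomisticToContinuum.Crystallization.Theorems.PalmUnimodularRigidityShellsToBarlowChartTransportDefs

/-!
# Line `develop-the-model-growth-descent` (crux `ShellsToBarlowChart`, stmt-AtomisticToContinuum-9227): frame transports (definitions)

Definitions (D-0016: reviewed; the lemmas live in the sibling proof files
`PalmUnimodularRigidityShellsToBarlowChartTransport*.lean`) of the six FRAME TRANSPORTS of the
geometric half `stub_transportSystem` and of the `ℤ³`-indexed development `frameAt`.

A site `x` of an every-point-good set carries an integer chart (`IsZChart`, file
`…TransportDefs`): a pattern `Pc x ∈ {fcc3Int, hcpInt}` and a labelling `nb x : ℤ³ → ℝ³` of its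
twelve bonded neighbours; `zlab Pc nb x` is the inverse labelling.  A frame (`ZFrame`) is a site
with an ordered touching pair of labels `(t₁, t₂)` spanning a hexagon of the pattern and an upper
cap `U`.  The transports move a frame to a bonded site and re-express the two in-layer directions
and the upper cap in the chart of the new site, using ONLY labels of common neighbours (so that
every identity between transports is a statement about two or three adjacent shells):

* `Istep` / `IinvStep` — along `+t₁` / `−t₁` (model: `(k,i,j) ↦ (k,i±1,j)`);
* `Jstep` / `JinvStep` — along `+t₂` / `−t₂` (model: `(k,i,j) ↦ (k,i,j±1)`);
* `Vstep` / `VinvStep` — to the apex of the upper / lower cap (model: `(k,i,j) ↦ (k±1,i,j)`;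
  the apex of a cap `{c, c ∓ t₁, c ∓ t₂}` is `c`, the site over the hole through `x`);
* `lowerParity` — the Hägg letter of the layer BELOW, read on the lower cap;
* `zIter`, `frameAt f₀ k i j := V^k (I^i (J^j f₀))` — the development indexed by `ℤ³`.

All definitions are total (junk outside their intended domain) and noncomputable (inverse
labellings, one `Classical.choose` of the apex); every `Finset.filter` / `if` uses the genuine
(computable) decidability instances, so that on explicit patterns the caps reduce by `decide`.  All `[folklore]` (Hales's layer picture,
HalesDSP2012 §1.3, in chart coordinates).
-/

noncomputable section

namespace Summit.AtomisticToContinuum.Crystallization.Theorems.PalmUnimodularRigidityShellsToBarlowChart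

open Literature.Geometry.DiscreteGeometry Literature.MathematicalPhysics.StatisticalMechanics

/-- Euclidean `3`-space. -/
local notation "E3" => EuclideanSpace ℝ (Fin 3)

/-- A **frame**: a site `pt`, the two in-layer label directions `t₁, t₂` (touching, at `60°`)
and the upper cap `U` (three labels), all in the integer chart of `pt`.  Validity is the
predicate `IsFrame (Pc pt) t₁ t₂ U`; the structure itself carries no proof. [folklore] -/
structure ZFrame where
  /-- the site -/
  pt : E3
  /-- first in-layer direction (label of the neighbour `(k,i+1,j)`) -/
  t₁ : Fin 3 → ℤ
  /-- second in-layer direction (label of the neighbour `(k,i,j+1)`) -/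
  t₂ : Fin 3 → ℤ
  /-- the upper cap (labels of the three neighbours in layer `k+1`) -/
  U : Finset (Fin 3 → ℤ)

variable (Pc : E3 → Finset (Fin 3 → ℤ)) (nb : E3 → (Fin 3 → ℤ) → E3)

/-- Frame validity is decidable (all clauses are finite checks on `ℤ³`), so that the pattern
facts of the development are proved by `decide`. [folklore] -/
instance instDecidableIsFrame (P : Finset (Fin 3 → ℤ)) (t₁ t₂ : Fin 3 → ℤ)
    (U : Finset (Fin 3 → ℤ)) : Decidable (IsFrame P t₁ t₂ U) := by
  unfold IsFrame; infer_instance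

/-- The inverse labelling at the site `y`: `zlab Pc nb y z` is the label `t ∈ Pc y` with
`nb y t = z` (for a bonded neighbour `z` of `y`; junk otherwise). [folklore] -/
def zlab (y : E3) : E3 → (Fin 3 → ℤ) := Function.invFunOn (nb y) (↑(Pc y) : Set (Fin 3 → ℤ))

/-- The cap of the pattern `P`, off the hexagon of `(t₁, t₂)`, on the side of the label `μ`
(`μ` and the off-hexagon labels touching it). [folklore] -/
def capWith (P : Finset (Fin 3 → ℤ)) (t₁ t₂ μ : Fin 3 → ℤ) : Finset (Fin 3 → ℤ) :=
  P.filter fun p => p ∉ hexLabels t₁ t₂ ∧ (p = μ ∨ sqNormInt (p - μ) = 18)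

/-- The cap of the pattern `P`, off the hexagon of `(t₁, t₂)`, on the side OPPOSITE to the
label `μ`. [folklore] -/
def capOpp (P : Finset (Fin 3 → ℤ)) (t₁ t₂ μ : Fin 3 → ℤ) : Finset (Fin 3 → ℤ) :=
  P.filter fun p => p ∉ hexLabels t₁ t₂ ∧ p ≠ μ ∧ sqNormInt (p - μ) ≠ 18

/-- The cap of the new site containing the transported images `μs` of upper references.
[folklore] -/
def capWithAny (P : Finset (Fin 3 → ℤ)) (t₁ t₂ : Fin 3 → ℤ) (μs : Finset (Fin 3 → ℤ)) :
    Finset (Fin 3 → ℤ) :=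
  P.filter fun p => p ∉ hexLabels t₁ t₂ ∧ ∃ m ∈ μs, p = m ∨ sqNormInt (p - m) = 18

/-- **Transport along `+t₁`** (`(k,i,j) ↦ (k,i+1,j)`).  New site `y = nb x t₁`; in the chart of
`y`: first direction `−w` (`w` = label of `x`), second direction `v − w` (`v` = label of the
common neighbour `nb x t₂`), upper cap = the cap containing the label of the transported upper
reference `nb x c` (`c ∈ U` touching `t₁`, a common neighbour of `x` and `y`). [folklore] -/
def Istep (f : ZFrame) : ZFrame :=
  let y := nb f.pt f.t₁
  let w := zlab Pc nb y f.pt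
  let v := zlab Pc nb y (nb f.pt f.t₂)
  { pt := y, t₁ := -w, t₂ := v - w,
    U := capWithAny (Pc y) (-w) (v - w)
      ((f.U.filter fun c => sqNormInt (c - f.t₁) = 18).image fun c => zlab Pc nb y (nb f.pt c)) }

/-- **Transport along `−t₁`** (`(k,i,j) ↦ (k,i−1,j)`).  New site `y = nb x (−t₁)`; first
direction `w` (label of `x`), second direction = label of the common neighbour `nb x (t₂ − t₁)`,
upper cap transported through the `U`-element touching `−t₁`. [folklore] -/
def IinvStep (f : ZFrame) : ZFrame :=
  let y := nb f.pt (-f.t₁)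
  let w := zlab Pc nb y f.pt
  let v := zlab Pc nb y (nb f.pt (f.t₂ - f.t₁))
  { pt := y, t₁ := w, t₂ := v,
    U := capWithAny (Pc y) w v
      ((f.U.filter fun c => sqNormInt (c + f.t₁) = 18).image fun c => zlab Pc nb y (nb f.pt c)) }

/-- **Transport along `+t₂`** (`(k,i,j) ↦ (k,i,j+1)`).  New site `y = nb x t₂`; first direction
`v − w` (`v` = label of `nb x t₁`, `w` = label of `x`), second direction `−w`. [folklore] -/
def Jstep (f : ZFrame) : ZFrame :=
  let y := nb f.pt f.t₂
  let w := zlab Pc nb y f.pt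
  let v := zlab Pc nb y (nb f.pt f.t₁)
  { pt := y, t₁ := v - w, t₂ := -w,
    U := capWithAny (Pc y) (v - w) (-w)
      ((f.U.filter fun c => sqNormInt (c - f.t₂) = 18).image fun c => zlab Pc nb y (nb f.pt c)) }

/-- **Transport along `−t₂`** (`(k,i,j) ↦ (k,i,j−1)`).  New site `y = nb x (−t₂)`; first
direction = label of the common neighbour `nb x (t₁ − t₂)`, second direction `w` (label of `x`).
[folklore] -/
def JinvStep (f : ZFrame) : ZFrame :=
  let y := nb f.pt (-f.t₂)
  let w := zlab Pc nb y f.pt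
  let v := zlab Pc nb y (nb f.pt (f.t₁ - f.t₂))
  { pt := y, t₁ := v, t₂ := w,
    U := capWithAny (Pc y) v w
      ((f.U.filter fun c => sqNormInt (c + f.t₂) = 18).image fun c => zlab Pc nb y (nb f.pt c)) }

/-- The **apex** label of a cap `C` with respect to `(t₁, t₂)`: the label `c ∈ C` with
`c − t₁, c − t₂ ∈ C` (even cap) or `c + t₁, c + t₂ ∈ C` (odd cap) — the neighbour over the
hole through the centre, i.e. the site `(k ± 1, i, j)` (junk `0` if there is none). [folklore] -/
def apexOf (t₁ t₂ : Fin 3 → ℤ) (C : Finset (Fin 3 → ℤ)) : Fin 3 → ℤ :=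
  if h : ∃ c ∈ C, (c - t₁ ∈ C ∧ c - t₂ ∈ C) ∨ (c + t₁ ∈ C ∧ c + t₂ ∈ C) then Classical.choose h
  else 0

/-- **The Hägg letter read on a cap**: `+1` if the cap `C` has the odd translation form
`{c, c + t₁, c + t₂}`, else `−1`.  On the LOWER cap of a frame at a site of layer `k` this is
the letter `s (k−1)` of the layer below (`BarlowCoordination.threeOffsets`: for `s (k−1) = 1`
the lower contacts of `(k,i,j)` are `(k−1,i,j), (k−1,i+1,j), (k−1,i,j+1)`). [folklore] -/
def lowerParity (t₁ t₂ : Fin 3 → ℤ) (C : Finset (Fin 3 → ℤ)) : ℤ :=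
  if ∃ c ∈ C, c + t₁ ∈ C ∧ c + t₂ ∈ C then 1 else -1

/-- The lower cap of a frame: the labels off the hexagon and off the upper cap. [folklore] -/
def lowerCap (P : Finset (Fin 3 → ℤ)) (t₁ t₂ : Fin 3 → ℤ) (U : Finset (Fin 3 → ℤ)) :
    Finset (Fin 3 → ℤ) :=
  P.filter fun p => p ∉ hexLabels t₁ t₂ ∧ p ∉ U

/-- **Transport to the next layer** (`(k,i,j) ↦ (k+1,i,j)`).  New site `u = nb x c`, `c` the apex
of the upper cap; in the chart of `u` (`ξ` = label of `x`): if the frame is even (`c` touches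
`t₁, t₂`, i.e. `x, nb x t₁, nb x t₂` are the lower neighbours of `u`) the directions are
`zlab u (nb x t₁) − ξ`, `zlab u (nb x t₂) − ξ`; if it is odd (`x, nb x (−t₁), nb x (−t₂)`
below `u`) they are `ξ − zlab u (nb x (−t₁))`, `ξ − zlab u (nb x (−t₂))`; the new upper cap is
the cap of `u` opposite to `ξ`. [folklore] -/
def Vstep (f : ZFrame) : ZFrame :=
  let c := apexOf f.t₁ f.t₂ f.U
  let u := nb f.pt c
  let ξ := zlab Pc nb u f.pt
  let t₁' := if frameParity f.t₁ f.t₂ f.U = 1 then zlab Pc nb u (nb f.pt f.t₁) - ξ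
    else ξ - zlab Pc nb u (nb f.pt (-f.t₁))
  let t₂' := if frameParity f.t₁ f.t₂ f.U = 1 then zlab Pc nb u (nb f.pt f.t₂) - ξ
    else ξ - zlab Pc nb u (nb f.pt (-f.t₂))
  { pt := u, t₁ := t₁', t₂ := t₂', U := capOpp (Pc u) t₁' t₂' ξ }

/-- **Transport to the previous layer** (`(k,i,j) ↦ (k−1,i,j)`), the mirror image of `Vstep`.
New site `d = nb x c'`, `c'` the apex of the lower cap `L`; in the chart of `d` (`ξ` = label of
`x`): if `L` reads letter `+1` (`L = {c', c' + t₁, c' + t₂}`; the upper neighbours of `d` are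
`x, nb x (−t₁), nb x (−t₂)`, i.e. `(k,i,j), (k,i−1,j), (k,i,j−1)`) the directions are
`ξ − zlab d (nb x (−t₁))`, `ξ − zlab d (nb x (−t₂))`; if it reads `−1`
(`L = {c', c' − t₁, c' − t₂}`; upper neighbours `x, nb x t₁, nb x t₂`) they are
`zlab d (nb x t₁) − ξ`, `zlab d (nb x t₂) − ξ`; the new upper cap is the cap of `d` containing
`ξ`. [folklore] -/
def VinvStep (f : ZFrame) : ZFrame :=
  let L := lowerCap (Pc f.pt) f.t₁ f.t₂ f.U
  let c := apexOf f.t₁ f.t₂ L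
  let d := nb f.pt c
  let ξ := zlab Pc nb d f.pt
  let t₁' := if lowerParity f.t₁ f.t₂ L = 1 then ξ - zlab Pc nb d (nb f.pt (-f.t₁))
    else zlab Pc nb d (nb f.pt f.t₁) - ξ
  let t₂' := if lowerParity f.t₁ f.t₂ L = 1 then ξ - zlab Pc nb d (nb f.pt (-f.t₂))
    else zlab Pc nb d (nb f.pt f.t₂) - ξ
  { pt := d, t₁ := t₁', t₂ := t₂', U := capWith (Pc d) t₁' t₂' ξ }

/-- Iterating a step and its inverse along `ℤ`: `zIter fwd bwd n = fwd^[n]` for `n ≥ 0` and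
`bwd^[−n]` for `n < 0`. [folklore] -/
def zIter {α : Type} (fwd bwd : α → α) : ℤ → α → α
  | (Int.ofNat n), a => fwd^[n] a
  | (Int.negSucc n), a => bwd^[n + 1] a

/-- **The development indexed by `ℤ³`**: `frameAt f₀ k i j = V^k (I^i (J^j f₀))` (negative
exponents through the inverse transports).  Its point map is the covering `Ψ (barlowPos 1 √(2/3) s
k i j)` of the line, once the charts are those of an every-point-good set and `f₀` is a base
frame. [folklore] -/
def frameAt (f₀ : ZFrame) (k i j : ℤ) : ZFrame :=
  zIter (Vstep Pc nb) (VinvStep Pc nb) k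
    (zIter (Istep Pc nb) (IinvStep Pc nb) i (zIter (Jstep Pc nb) (JinvStep Pc nb) j f₀))

/-- Anchor (registered sub-goal of stmt-AtomisticToContinuum-9227): `zIter` at `0` is the
identity. [folklore] -/
theorem zIter_zero_apply : ∀ (fwd bwd : ZFrame → ZFrame) (a : ZFrame), zIter fwd bwd 0 a = a := by
  intro fwd bwd a
  rfl

end Summit.AtomisticToContinuum.Crystallization.Theorems.PalmUnimodularRigidityShellsToBarlowChart

end
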